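import Summits.CriticalPhenomena.PercolationContinuityZ3.Theorems.Transplant.FKConnectivityAllQAntipodalAndGenSides
import HarnessLib

/-!
# Connectivity correlation inequalities for `φ_{w,q}`, every `q > 0` — file 32bW: the general AND-drift with a LEVEL WEIGHT — trivial cases and
# the DOUBLED-ROOT decomposition for ANTITONE weights (towards Conjecture AND⁺ / C_∞⁺ for the AND type)

Support file (`--supports stmt-CriticalPhenomena-4575`), FK sub-lane `prim-bschramm-fk-2` (gen 21); builds on p205010 (kernel theorem,
internal audit signed; external expert review pending).  No definitions, no named facts, no sorries; standard axioms.

THE PROGRAMME (memo FROM-fk-2-g21-QFREE §6).  Gen 19's master AND theorem (`…AndGenPath.lean`: the general AND-drift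
`D_q(N, A, C; e) = ∑_{γ ⊆ N} (q^{k(γ∪A∪e)+k((N\γ)∪C)} − q^{k((N\γ)∪A∪e)+k(γ∪C)}) h(γ) ≤ 0` on two-terminal series–parallel hosts, `0 < q ≤ 1`)
rests on identities in which every term is `(0/1 coefficient) · q^{shift} · (a smaller drift summand)` (files 32, 32a) plus the doubled-root step
(file 32b), whose remainder is signed because `q^{a} ≤ q^{b}` for `a ≥ b`, `q ≤ 1`.  Replacing `q^ℓ` by an arbitrary ANTITONE weight `w(ℓ)`
(the class is shift-invariant and contains `1_{· ≤ J}`) turns the whole induction into a proof of gen 17's Conjecture AND⁺ — the level form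
`∑_{γ : level ≤ J} (…) ≤ 0`, i.e. `a_S(q)/(q−1)` has nonnegative coefficients — exactly as gen 18's `…AntipodalWeightUpc.lean` did for Theorem U.
THIS FILE is file 32b with weights:
* `FK.andGenW_sum_empty`, `FK.andGenW_rootless_sum_empty`, `FK.andGenW_rootless_self` — the trivial cases for every `w`;
* **`FK.andGenW_doubled`** — for ANTITONE `w`: if the weighted drift with root `e` on `N \ e` and the weighted rootless drift on `N \ e` with `e`
  attached and contracted are `≤ 0` on monotone test functions, so is the weighted drift with root `e ∈ N` on `N` (the remainder
  `∑ (w(Z̄'+Φ') − w(Z̄'+B'))(h(γ'∪e) − h γ')` has `B' ≤ Φ'`, hence is `≤ 0` termwise by antitonicity).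
[cite: Grimmett2006, §1.4 eq. (1.20) (p. 15); §3.8 Thm. (3.90) (pp. 61–62); §3.9 (pp. 63–64)] [cite: Wagner2006, Thm. 5.8(d), §5.3]
-/

noncomputable section

namespace Summit.CriticalPhenomena.PercolationContinuityZ3.Theorems

namespace FK

open SimpleGraph Literature.Probability.LatticeModels Literature.Probability.Percolation
open scoped Classical

variable {V : Type*} [Fintype V]

section GenSidesW

variable {u v : V}

omit [Fintype V] in
/-- The weighted general AND-drift over the empty free set vanishes. [folklore] -/
theorem andGenW_sum_empty (w : ℕ → ℝ) (A C : Finset (Sym2 V)) (e : Sym2 V) (h : Finset (Sym2 V) → ℝ) :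
    ∑ γ ∈ (∅ : Finset (Sym2 V)).powerset,
        (w (clusterCount (↑(insert e (γ ∪ A)) : BondConfig V) ∅ + clusterCount (↑(∅ \ γ ∪ C) : BondConfig V) ∅) -
            w (clusterCount (↑(insert e (∅ \ γ ∪ A)) : BondConfig V) ∅ + clusterCount (↑(γ ∪ C) : BondConfig V) ∅)) * h γ = 0 := by
  rw [Finset.powerset_empty, Finset.sum_singleton, Finset.sdiff_self]
  ring

omit [Fintype V] in
/-- The weighted rootless general AND-drift over the empty free set vanishes. [folklore] -/
theorem andGenW_rootless_sum_empty (w : ℕ → ℝ) (A C : Finset (Sym2 V)) (h : Finset (Sym2 V) → ℝ) :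
    ∑ γ ∈ (∅ : Finset (Sym2 V)).powerset,
        (w (clusterCount (↑(γ ∪ A) : BondConfig V) ∅ + clusterCount (↑(∅ \ γ ∪ C) : BondConfig V) ∅) -
            w (clusterCount (↑(∅ \ γ ∪ A) : BondConfig V) ∅ + clusterCount (↑(γ ∪ C) : BondConfig V) ∅)) * h γ = 0 := by
  rw [Finset.powerset_empty, Finset.sum_singleton, Finset.sdiff_self]
  ring

omit [Fintype V] in
/-- The weighted rootless general AND-drift with equal attached and contracted sets vanishes termwise. [folklore] -/
theorem andGenW_rootless_self (w : ℕ → ℝ) (N A : Finset (Sym2 V)) (h : Finset (Sym2 V) → ℝ) :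
    ∑ γ ∈ N.powerset,
        (w (clusterCount (↑(γ ∪ A) : BondConfig V) ∅ + clusterCount (↑(N \ γ ∪ A) : BondConfig V) ∅) -
            w (clusterCount (↑(N \ γ ∪ A) : BondConfig V) ∅ + clusterCount (↑(γ ∪ A) : BondConfig V) ∅)) * h γ = 0 := by
  refine Finset.sum_eq_zero fun γ _ => ?_
  rw [add_comm (clusterCount (↑(N \ γ ∪ A) : BondConfig V) ∅), sub_self, zero_mul]

/-- **The doubled root, weighted (antitone weights).**  Let `e ∈ N` and `N' = N \ e`.  If the weighted drift with root `e` on `N'` (attached `A`,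
contracted `C`) and the weighted rootless drift on `N'` with `e` attached AND contracted are `≤ 0` on every monotone test function, then the
weighted drift with root `e` on `N` is `≤ 0` on every monotone `h`, for every antitone `w`: splitting by the `e`-coordinate, the sum is the
first input against `h(· ∪ e)`, plus the second against `h`, plus `∑ (w(Z̄'+Φ') − w(Z̄'+B'))(h(γ' ∪ e) − h(γ'))`, nonpositive termwise since
`B' = k(γ' ∪ C ∪ e) ≤ Φ' = k(γ' ∪ C)`, `w` is antitone and `h` is monotone. [cite: Grimmett2006, §1.4 eq. (1.20) (p. 15), Thm. (3.1)(a)] -/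
theorem andGenW_doubled {w : ℕ → ℝ} (hw : ∀ n : ℕ, w (n + 1) ≤ w n) {N A C : Finset (Sym2 V)} (heN : s(u, v) ∈ N)
    (hrec : ∀ h' : Finset (Sym2 V) → ℝ, (∀ ⦃X Y : Finset (Sym2 V)⦄, X ⊆ Y → Y ⊆ N.erase s(u, v) → h' X ≤ h' Y) →
      ∑ γ ∈ (N.erase s(u, v)).powerset,
        (w (clusterCount (↑(insert s(u, v) (γ ∪ A)) : BondConfig V) ∅ + clusterCount (↑(N.erase s(u, v) \ γ ∪ C) : BondConfig V) ∅) -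
          w (clusterCount (↑(insert s(u, v) (N.erase s(u, v) \ γ ∪ A)) : BondConfig V) ∅ +
            clusterCount (↑(γ ∪ C) : BondConfig V) ∅)) * h' γ ≤ 0)
    (hcon : ∀ h' : Finset (Sym2 V) → ℝ, (∀ ⦃X Y : Finset (Sym2 V)⦄, X ⊆ Y → Y ⊆ N.erase s(u, v) → h' X ≤ h' Y) →
      ∑ γ ∈ (N.erase s(u, v)).powerset,
        (w (clusterCount (↑(insert s(u, v) (γ ∪ A)) : BondConfig V) ∅ +
              clusterCount (↑(insert s(u, v) (N.erase s(u, v) \ γ ∪ C)) : BondConfig V) ∅) -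
          w (clusterCount (↑(insert s(u, v) (N.erase s(u, v) \ γ ∪ A)) : BondConfig V) ∅ +
              clusterCount (↑(insert s(u, v) (γ ∪ C)) : BondConfig V) ∅)) * h' γ ≤ 0)
    {h : Finset (Sym2 V) → ℝ} (hmono : ∀ ⦃X Y : Finset (Sym2 V)⦄, X ⊆ Y → Y ⊆ N → h X ≤ h Y) :
    ∑ γ ∈ N.powerset,
        (w (clusterCount (↑(insert s(u, v) (γ ∪ A)) : BondConfig V) ∅ + clusterCount (↑(N \ γ ∪ C) : BondConfig V) ∅) -
            w (clusterCount (↑(insert s(u, v) (N \ γ ∪ A)) : BondConfig V) ∅ + clusterCount (↑(γ ∪ C) : BondConfig V) ∅)) * h γ ≤ 0 := by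
  have hanti : ∀ a b : ℕ, a ≤ b → w b ≤ w a := fun a b hab => by
    induction hab with
    | refl => exact le_rfl
    | step _ ih => exact (hw _).trans ih
  set N' := N.erase s(u, v) with hN'
  have hN : N = insert s(u, v) N' := (Finset.insert_erase heN).symm
  have heN' : s(u, v) ∉ N' := Finset.notMem_erase _ _
  have hN'N : N' ⊆ N := Finset.erase_subset _ _
  -- (1) the recursive input against `h(· ∪ e)`
  have hZ : ∑ γ ∈ N'.powerset,
      (w (clusterCount (↑(insert s(u, v) (γ ∪ A)) : BondConfig V) ∅ + clusterCount (↑(N' \ γ ∪ C) : BondConfig V) ∅) -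
          w (clusterCount (↑(insert s(u, v) (N' \ γ ∪ A)) : BondConfig V) ∅ + clusterCount (↑(γ ∪ C) : BondConfig V) ∅)) *
        h (insert s(u, v) γ) ≤ 0 :=
    hrec (fun γ => h (insert s(u, v) γ)) fun X Y hXY hY =>
      hmono (Finset.insert_subset_insert _ hXY) (Finset.insert_subset heN (hY.trans hN'N))
  -- (2) the contracted input against `h`
  have hC := hcon h fun X Y hXY hY => hmono hXY (hY.trans hN'N)
  -- (3) split the sum by the `e`-coordinate
  rw [hN, Finset.sum_powerset_insert heN']
  have e1 : ∀ γ ∈ N'.powerset, insert s(u, v) N' \ γ = insert s(u, v) (N' \ γ) := fun γ hγ =>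
    Finset.insert_sdiff_of_notMem _ (fun hh => heN' (Finset.mem_powerset.1 hγ hh))
  have e2 : ∀ γ : Finset (Sym2 V), insert s(u, v) N' \ insert s(u, v) γ = N' \ γ := fun γ => by
    rw [Finset.insert_sdiff_insert, Finset.sdiff_insert_of_notMem heN']
  have e3 : ∀ X : Finset (Sym2 V), insert s(u, v) (insert s(u, v) X ∪ A) = insert s(u, v) (X ∪ A) := fun X => by
    rw [Finset.insert_union, Finset.insert_idem]
  have e4 : ∀ X : Finset (Sym2 V), insert s(u, v) X ∪ C = insert s(u, v) (X ∪ C) := fun X => Finset.insert_union _ _ _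
  have hS1 : ∑ γ ∈ N'.powerset,
      (w (clusterCount (↑(insert s(u, v) (γ ∪ A)) : BondConfig V) ∅ + clusterCount (↑(insert s(u, v) N' \ γ ∪ C) : BondConfig V) ∅) -
          w (clusterCount (↑(insert s(u, v) (insert s(u, v) N' \ γ ∪ A)) : BondConfig V) ∅ + clusterCount (↑(γ ∪ C) : BondConfig V) ∅)) *
        h γ =
      ∑ γ ∈ N'.powerset,
      (w (clusterCount (↑(insert s(u, v) (γ ∪ A)) : BondConfig V) ∅ + clusterCount (↑(insert s(u, v) (N' \ γ ∪ C)) : BondConfig V) ∅) -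
          w (clusterCount (↑(insert s(u, v) (N' \ γ ∪ A)) : BondConfig V) ∅ + clusterCount (↑(γ ∪ C) : BondConfig V) ∅)) * h γ := by
    refine Finset.sum_congr rfl fun γ hγ => ?_
    rw [e1 γ hγ, e3, e4]
  have hS2 : ∑ γ ∈ N'.powerset,
      (w (clusterCount (↑(insert s(u, v) (insert s(u, v) γ ∪ A)) : BondConfig V) ∅ +
            clusterCount (↑(insert s(u, v) N' \ insert s(u, v) γ ∪ C) : BondConfig V) ∅) -
          w (clusterCount (↑(insert s(u, v) (insert s(u, v) N' \ insert s(u, v) γ ∪ A)) : BondConfig V) ∅ +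
            clusterCount (↑(insert s(u, v) γ ∪ C) : BondConfig V) ∅)) * h (insert s(u, v) γ) =
      ∑ γ ∈ N'.powerset,
      (w (clusterCount (↑(insert s(u, v) (γ ∪ A)) : BondConfig V) ∅ + clusterCount (↑(N' \ γ ∪ C) : BondConfig V) ∅) -
          w (clusterCount (↑(insert s(u, v) (N' \ γ ∪ A)) : BondConfig V) ∅ +
            clusterCount (↑(insert s(u, v) (γ ∪ C)) : BondConfig V) ∅)) * h (insert s(u, v) γ) := by
    refine Finset.sum_congr rfl fun γ _ => ?_
    rw [e2 γ, e3, e4]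
  rw [hS1, hS2]
  -- (4) the remainder is pointwise nonpositive: `w` is antitone and inserting `e` lowers the cluster count
  have hB : ∀ (Z : ℕ) (X : Finset (Sym2 V)),
      w (Z + clusterCount (↑X : BondConfig V) ∅) ≤ w (Z + clusterCount (↑(insert s(u, v) X) : BondConfig V) ∅) := by
    intro Z X
    have i := clusterCount_insert_add_ite X u v
    exact hanti _ _ (by omega)
  have rem : ∑ γ ∈ N'.powerset,
      (w (clusterCount (↑(insert s(u, v) (N' \ γ ∪ A)) : BondConfig V) ∅ + clusterCount (↑(γ ∪ C) : BondConfig V) ∅) -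
        w (clusterCount (↑(insert s(u, v) (N' \ γ ∪ A)) : BondConfig V) ∅ +
          clusterCount (↑(insert s(u, v) (γ ∪ C)) : BondConfig V) ∅)) * (h (insert s(u, v) γ) - h γ) ≤ 0 := by
    refine Finset.sum_nonpos fun γ hγ => ?_
    rw [Finset.mem_powerset] at hγ
    exact mul_nonpos_of_nonpos_of_nonneg (sub_nonpos.2 (hB _ (γ ∪ C)))
      (sub_nonneg.2 (hmono (Finset.subset_insert _ _) (Finset.insert_subset heN (hγ.trans hN'N))))
  have split : ∑ γ ∈ N'.powerset,
        (w (clusterCount (↑(insert s(u, v) (γ ∪ A)) : BondConfig V) ∅ + clusterCount (↑(insert s(u, v) (N' \ γ ∪ C)) : BondConfig V) ∅) -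
            w (clusterCount (↑(insert s(u, v) (N' \ γ ∪ A)) : BondConfig V) ∅ + clusterCount (↑(γ ∪ C) : BondConfig V) ∅)) * h γ +
      ∑ γ ∈ N'.powerset,
        (w (clusterCount (↑(insert s(u, v) (γ ∪ A)) : BondConfig V) ∅ + clusterCount (↑(N' \ γ ∪ C) : BondConfig V) ∅) -
            w (clusterCount (↑(insert s(u, v) (N' \ γ ∪ A)) : BondConfig V) ∅ +
              clusterCount (↑(insert s(u, v) (γ ∪ C)) : BondConfig V) ∅)) * h (insert s(u, v) γ) =
      ∑ γ ∈ N'.powerset,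
        (w (clusterCount (↑(insert s(u, v) (γ ∪ A)) : BondConfig V) ∅ + clusterCount (↑(N' \ γ ∪ C) : BondConfig V) ∅) -
            w (clusterCount (↑(insert s(u, v) (N' \ γ ∪ A)) : BondConfig V) ∅ + clusterCount (↑(γ ∪ C) : BondConfig V) ∅)) *
          h (insert s(u, v) γ) +
      ∑ γ ∈ N'.powerset,
        (w (clusterCount (↑(insert s(u, v) (γ ∪ A)) : BondConfig V) ∅ +
              clusterCount (↑(insert s(u, v) (N' \ γ ∪ C)) : BondConfig V) ∅) -
          w (clusterCount (↑(insert s(u, v) (N' \ γ ∪ A)) : BondConfig V) ∅ +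
              clusterCount (↑(insert s(u, v) (γ ∪ C)) : BondConfig V) ∅)) * h γ +
      ∑ γ ∈ N'.powerset,
        (w (clusterCount (↑(insert s(u, v) (N' \ γ ∪ A)) : BondConfig V) ∅ + clusterCount (↑(γ ∪ C) : BondConfig V) ∅) -
          w (clusterCount (↑(insert s(u, v) (N' \ γ ∪ A)) : BondConfig V) ∅ +
            clusterCount (↑(insert s(u, v) (γ ∪ C)) : BondConfig V) ∅)) * (h (insert s(u, v) γ) - h γ) := by
    rw [← Finset.sum_add_distrib, ← Finset.sum_add_distrib, ← Finset.sum_add_distrib]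
    refine Finset.sum_congr rfl fun γ _ => ?_
    ring
  rw [split]
  linarith

end GenSidesW

end FK

end Summit.CriticalPhenomena.PercolationContinuityZ3.Theorems

end
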